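import Literature.InformationTheory.Entanglement.PureStateNegativity
import Mathlib.Analysis.Convex.Jensen
import Mathlib.Analysis.Convex.SpecificFunctions.Basic
import Mathlib.Analysis.SpecialFunctions.Log.Base
import HarnessLib

/-!
# `E(Φ) ≤ E_𝒩(Φ)`: the entropy of entanglement of a pure state is at most its logarithmic negativity, with equality
# exactly for (zero-padded) maximally entangled states (Vidal–Werner 2002, § V.A, eq. (17)–(18))

Hodge foundations lane (`lit-hodgefound`, prover p24 gen 77; quantum-information series, sequel of
`PureStateNegativity.lean`).  THEOREMS ONLY: no definition, no named fact, net debt 0.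

## Source, VERBATIM

G. Vidal, R. F. Werner, *Computable measure of entanglement*, Phys. Rev. A **65** (2002) 032314 [VidalWerner2002],
§ V.A (held `paper:arxiv-quant-ph_0102117`, chunk p0011), after Proposition 8 (`𝒩(ρ) = ½((Σ_α c_α)² − 1)`, hence
`E_𝒩(ρ) = log₂‖ρ^{T_A}‖₁ = 2 log₂(Σ_α c_α)`): «Since `E_𝒩` is an upper bound on the distillation rate, and that rate is
known to be `E(ρ)`, the von Neumann entropy of the restricted state, we know that `E_𝒩(ρ) ≥ E(ρ)`. But of course, we
can get this more directly: using the concavity of the logarithm, we get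
`E(ρ) = 2 Σ_α c_α² log₂(1/c_α) ≤ 2 log₂(Σ_α c_α) = E_𝒩(ρ)`. (17)–(18)
This derivation also allows the characterization of the cases of equality: Since the logarithm is strictly concave,
we get equality if and only if all non-zero `c_α` are equal. Hence equality for pure states holds exactly for maximally
entangled states (which may have been expanded by zeros to live on a larger Hilbert space).»

## Dictionary (no definitions introduced)

* The Schmidt coefficients are `σ : m → ℝ`, `σ ≥ 0`, `Σ_α σ_α² = 1` (as produced by
  `PureStateNegativity.vidalWerner_prop8`); `E(ρ) = 2 Σ_α σ_α² log(1/σ_α) = −Σ_α σ_α² log σ_α²` (the printed formula (17),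
  the Shannon entropy of the Schmidt vector; Mathlib's `Real.log 0 = 0` makes the `σ_α = 0` terms vanish, as intended);
  `E_𝒩(ρ) = log‖ρ^{T_A}‖₁ = 2 log(Σ_α σ_α)`.  Natural logarithms throughout; the base-2 statements follow on dividing by
  `log 2 > 0` (`…_logb`).

## What is formalized (all PROVED)

* `neg_sum_sq_mul_log_sq_le` (**(17)–(18)**: `−Σ σ_α² log σ_α² ≤ 2 log Σ_α σ_α`, by Jensen for the strictly concave `log`
  with weights `σ_α²` at the points `1/σ_α`, `σ_α ≠ 0`), `neg_sum_sq_mul_logb_sq_le` (base 2);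
* `neg_sum_sq_mul_log_sq_eq_iff` (**equality iff all non-zero `σ_α` are equal**);
* `entanglementEntropy_le_log_traceNorm_ptA_pure` (**`E(ρ) ≤ E_𝒩(ρ) = log‖ρ^{T_A}‖₁`** for every unit vector of
  `ℂ^m ⊗ ℂ^n`, `|m| ≤ |n|`, with the Schmidt data of `PureStateNegativity.vidalWerner_prop8`).

NOT formalized: the identification of `E` with the von Neumann entropy of the reduced state as a matrix function
(`E(ρ) = S(Tr_B ρ)`), the distillation-rate interpretation.

## Tree / Mathlib search (2026-08-31)

`rg -i "log.?negativ|renyi.*half|H_\\{1/2\\}" Literature` → ∅.  REUSED: `PureStateNegativity.vidalWerner_prop8`; Mathlib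
`strictConcaveOn_log_Ioi`, `ConcaveOn.le_map_sum`, `StrictConcaveOn.map_sum_eq_iff_of_nonneg`.

presearch: «logarithmic negativity upper bound entropy of entanglement pure state concavity of log equality maximally
entangled» → [corpus: arxiv quant-ph/0102117 § V.A (17)–(18)]; galaxy `"logarithmic negativity|log-negativity"` (pdf) →
VW and later reviews (Plenio 2005) only.

## References

* [VidalWerner2002] § V.A, eq. (17)–(18) and the equality discussion.
-/

noncomputable section

open Matrix Finset Real
open scoped ComplexOrder

namespace Literature.InformationTheory.Entanglement.PureStateLogNegativity

open Literature.InformationTheory.Entanglement.PPT (ptA)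
open Literature.InformationTheory.Entanglement.PureStateNegativity (vidalWerner_prop8)

section Jensen

variable {m : Type*} [Fintype m]

/-- The Jensen step: for `σ ≥ 0` with `Σσ² = 1`,
`Σ_{σ_α ≠ 0} σ_α² log(1/σ_α) ≤ log(Σ_{σ_α ≠ 0} σ_α² · (1/σ_α)) = log Σ_α σ_α` («using the concavity of the logarithm»).
[cite: VidalWerner2002, § V.A eq. (18)] -/
private theorem jensen_step (σ : m → ℝ) (hσ : ∀ i, 0 ≤ σ i) (h1 : ∑ i, σ i ^ 2 = 1) :
    ∑ i ∈ univ.filter (fun i => σ i ≠ 0), σ i ^ 2 * log ((σ i)⁻¹) ≤ log (∑ i, σ i) := by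
  classical
  have hw : ∑ i ∈ univ.filter (fun i => σ i ≠ 0), σ i ^ 2 = 1 := by
    rw [Finset.sum_filter_of_ne (fun i _ h => by intro h0; rw [h0] at h; simp at h), h1]
  have hsum : ∑ i ∈ univ.filter (fun i => σ i ≠ 0), σ i ^ 2 • (σ i)⁻¹ = ∑ i, σ i := by
    rw [← Finset.sum_filter_of_ne (s := univ) (f := σ) (p := fun i => σ i ≠ 0) (fun i _ h => h)]
    refine Finset.sum_congr rfl fun i hi => ?_
    have hi' : σ i ≠ 0 := (mem_filter.1 hi).2
    rw [smul_eq_mul, sq, mul_assoc, mul_inv_cancel₀ hi', mul_one]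
  have h := strictConcaveOn_log_Ioi.concaveOn.le_map_sum (t := univ.filter (fun i => σ i ≠ 0))
    (w := fun i => σ i ^ 2) (p := fun i => (σ i)⁻¹) (fun i _ => sq_nonneg _) hw
    (fun i hi => Set.mem_Ioi.2 (inv_pos.2 (lt_of_le_of_ne (hσ i) (Ne.symm (mem_filter.1 hi).2))))
  simp only [smul_eq_mul] at h hsum
  rw [hsum] at h
  exact h

/-- `−Σ σ² log σ² = 2 Σ_{σ ≠ 0} σ² log(1/σ)` («`E(ρ) = 2Σ_α c_α² log₂(1/c_α)`»; the `σ_α = 0` terms vanish).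
[cite: VidalWerner2002, § V.A eq. (17)] -/
private theorem neg_sum_eq_two_mul_sum_filter (σ : m → ℝ) (hσ : ∀ i, 0 ≤ σ i) :
    -∑ i, σ i ^ 2 * log (σ i ^ 2) = 2 * ∑ i ∈ univ.filter (fun i => σ i ≠ 0), σ i ^ 2 * log ((σ i)⁻¹) := by
  classical
  rw [Finset.mul_sum, ← Finset.sum_neg_distrib,
    ← Finset.sum_filter_of_ne (s := univ) (p := fun i => σ i ≠ 0) (fun i _ h => by
      intro h0; rw [h0] at h; simp at h)]
  refine Finset.sum_congr rfl fun i hi => ?_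
  have hi' : 0 < σ i := lt_of_le_of_ne (hσ i) (Ne.symm (mem_filter.1 hi).2)
  rw [Real.log_inv, Real.log_pow]
  push_cast
  ring

/-- **(17)–(18): `E(ρ) = −Σ_α σ_α² log σ_α² ≤ 2 log(Σ_α σ_α) = E_𝒩(ρ)`** for Schmidt coefficients `σ ≥ 0`,
`Σσ² = 1`. [cite: VidalWerner2002, § V.A eq. (17)–(18)] -/
theorem neg_sum_sq_mul_log_sq_le (σ : m → ℝ) (hσ : ∀ i, 0 ≤ σ i) (h1 : ∑ i, σ i ^ 2 = 1) :
    -∑ i, σ i ^ 2 * log (σ i ^ 2) ≤ 2 * log (∑ i, σ i) := by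
  rw [neg_sum_eq_two_mul_sum_filter σ hσ]
  exact mul_le_mul_of_nonneg_left (jensen_step σ hσ h1) (by norm_num)

/-- The same in bits: `−Σ σ² log₂ σ² ≤ 2 log₂ Σσ` (as printed). [cite: VidalWerner2002, § V.A eq. (17)–(18)] -/
theorem neg_sum_sq_mul_logb_sq_le (σ : m → ℝ) (hσ : ∀ i, 0 ≤ σ i) (h1 : ∑ i, σ i ^ 2 = 1) :
    -∑ i, σ i ^ 2 * logb 2 (σ i ^ 2) ≤ 2 * logb 2 (∑ i, σ i) := by
  have hlog2 : 0 < log 2 := Real.log_pos (by norm_num)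
  have h := neg_sum_sq_mul_log_sq_le σ hσ h1
  simp only [Real.logb, mul_div_assoc']
  rw [← Finset.sum_div, ← neg_div, div_le_div_iff_of_pos_right hlog2]
  exact h

/-- A unit Schmidt vector has `Σσ > 0`. [folklore] -/
private theorem sum_pos_of_sum_sq_eq_one (σ : m → ℝ) (hσ : ∀ i, 0 ≤ σ i) (h1 : ∑ i, σ i ^ 2 = 1) :
    0 < ∑ i, σ i := by
  by_contra h
  have h0 : ∑ i, σ i = 0 := le_antisymm (not_lt.1 h) (sum_nonneg fun i _ => hσ i)
  have hall : ∀ i, σ i = 0 := fun i => (Finset.sum_eq_zero_iff_of_nonneg (fun i _ => hσ i)).1 h0 i (mem_univ _)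
  simp [hall] at h1

/-- **The equality case: `E(ρ) = E_𝒩(ρ)` iff all non-zero `σ_α` are equal** («Since the logarithm is strictly concave, we
get equality if and only if all non-zero `c_α` are equal … exactly for maximally entangled states»).
[cite: VidalWerner2002, § V.A (after eq. (18))] -/
theorem neg_sum_sq_mul_log_sq_eq_iff (σ : m → ℝ) (hσ : ∀ i, 0 ≤ σ i) (h1 : ∑ i, σ i ^ 2 = 1) :
    -∑ i, σ i ^ 2 * log (σ i ^ 2) = 2 * log (∑ i, σ i) ↔ ∀ i j, σ i ≠ 0 → σ j ≠ 0 → σ i = σ j := by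
  classical
  have hw : ∑ i ∈ univ.filter (fun i => σ i ≠ 0), σ i ^ 2 = 1 := by
    rw [Finset.sum_filter_of_ne (fun i _ h => by intro h0; rw [h0] at h; simp at h), h1]
  have hsum : ∑ i ∈ univ.filter (fun i => σ i ≠ 0), σ i ^ 2 • (σ i)⁻¹ = ∑ i, σ i := by
    rw [← Finset.sum_filter_of_ne (s := univ) (f := σ) (p := fun i => σ i ≠ 0) (fun i _ h => h)]
    refine Finset.sum_congr rfl fun i hi => ?_
    have hi' : σ i ≠ 0 := (mem_filter.1 hi).2
    rw [smul_eq_mul, sq, mul_assoc, mul_inv_cancel₀ hi', mul_one]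
  have hiff := strictConcaveOn_log_Ioi.map_sum_eq_iff_of_nonneg (t := univ.filter (fun i => σ i ≠ 0))
    (w := fun i => σ i ^ 2) (p := fun i => (σ i)⁻¹) (fun i _ => sq_nonneg _) hw
    (fun i hi => Set.mem_Ioi.2 (inv_pos.2 (lt_of_le_of_ne (hσ i) (Ne.symm (mem_filter.1 hi).2))))
  rw [hsum] at hiff
  simp only [smul_eq_mul] at hiff
  rw [neg_sum_eq_two_mul_sum_filter σ hσ]
  constructor
  · intro h i j hi hj
    have heq : log (∑ i, σ i) = ∑ i ∈ univ.filter (fun i => σ i ≠ 0), σ i ^ 2 * log (σ i)⁻¹ := by linarith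
    have := hiff.1 heq (mem_filter.2 ⟨mem_univ _, hi⟩) (pow_ne_zero 2 hi) (mem_filter.2 ⟨mem_univ _, hj⟩)
      (pow_ne_zero 2 hj)
    exact _root_.inv_inj.1 this
  · intro h
    have heq := hiff.2 fun j hj _ k hk _ => by rw [_root_.inv_inj]; exact h j k (mem_filter.1 hj).2 (mem_filter.1 hk).2
    linarith

end Jensen

/-! ## `E(ρ) ≤ E_𝒩(ρ) = log‖ρ^{T_A}‖₁` for pure states -/

section PureStates

variable {m n : Type*} [Fintype m] [Fintype n] [DecidableEq m] [DecidableEq n]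

/-- **`E(ρ) ≤ E_𝒩(ρ)` for a pure state**: for a unit vector `Φ ∈ ℂ^m ⊗ ℂ^n` (`|m| ≤ |n|`, coefficient matrix `Ψ`) there
are Schmidt coefficients `σ ≥ 0`, `Σσ² = 1`, `ΨΨ^* = U diag(σ²)U^*`, with
`‖(|Φ⟩⟨Φ|)^{T_A}‖₁ = (Σσ)²` and `−Σ_α σ_α² log σ_α² ≤ log‖(|Φ⟩⟨Φ|)^{T_A}‖₁ = 2 log Σ_α σ_α`, equality iff all
non-zero `σ_α` coincide. [cite: VidalWerner2002, § V.A Prop. 8 and eq. (17)–(18)] -/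
theorem entanglementEntropy_le_log_traceNorm_ptA_pure (Ψ : Matrix m n ℂ) (hmn : Fintype.card m ≤ Fintype.card n)
    (hΨ1 : (Ψᴴ * Ψ).trace = 1)
    (hH : (ptA (vecMulVec (fun p : m × n => Ψ p.1 p.2) (star fun p : m × n => Ψ p.1 p.2))).IsHermitian) :
    ∃ σ : m → ℝ, (∀ i, 0 ≤ σ i) ∧
      (∃ U ∈ Matrix.unitaryGroup m ℂ, Ψ * Ψᴴ = U * diagonal (fun i => ((σ i ^ 2 : ℝ) : ℂ)) * star U) ∧
      ∑ i, σ i ^ 2 = 1 ∧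
      ∑ i, |hH.eigenvalues i| = (∑ i, σ i) ^ 2 ∧
      -∑ i, σ i ^ 2 * log (σ i ^ 2) ≤ log (∑ i, |hH.eigenvalues i|) ∧
      log (∑ i, |hH.eigenvalues i|) = 2 * log (∑ i, σ i) ∧
      (-∑ i, σ i ^ 2 * log (σ i ^ 2) = log (∑ i, |hH.eigenvalues i|) ↔ ∀ i j, σ i ≠ 0 → σ j ≠ 0 → σ i = σ j) := by
  obtain ⟨σ, hσ, hU, h1, -, habs, -⟩ := vidalWerner_prop8 Ψ hmn hΨ1 hH
  have hlog : log (∑ i, |hH.eigenvalues i|) = 2 * log (∑ i, σ i) := by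
    rw [habs, Real.log_pow]; push_cast; ring
  refine ⟨σ, hσ, hU, h1, habs, ?_, hlog, ?_⟩
  · rw [hlog]; exact neg_sum_sq_mul_log_sq_le σ hσ h1
  · rw [hlog]; exact neg_sum_sq_mul_log_sq_eq_iff σ hσ h1

end PureStates

end Literature.InformationTheory.Entanglement.PureStateLogNegativity
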